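import Mathlib
import Summits.ValiantsHypothesis.ValiantsHypothesis.Theorems.LiouvilleSarnakLiouvilleCutRankShiftCertificates
import HarnessLib

/-!
# Route LiouvilleSarnak — crux `LiouvilleCutRank` (stmt-ValiantsHypothesis-14775):
# swapping rows and columns transposes the cut matrix — the COLUMN duals of the shift certificates

Composing a cut `π : Fin n ⊕ Fin n ≃ Fin (2n)` with `Sum.swap` exchanges the roles of row and column bits; the cut
matrix becomes the transpose, so its rank is unchanged.  Hence every ROW-side criterion of the route has a COLUMN-side
dual.  This file records the transposition and the duals of `…ShiftCertificates` / `…NoAdjacentRows`: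

* `cutMatrix_swap_eq_transpose`, `rank_cutMatrix_swap` — `M_{π ∘ swap} = (M_π)ᵀ`, equal ranks.
* ★ `card_le_two_pow_rank_of_shift_cols` — `d ≥ 1`, `λ(2^d+1) = -1`, no two COLUMN positions at distance `d` ⟹
  `#{column positions j : j + d < 2n, no column in (j, j+d]} ≤ 2^{rank M_π}`.
* ★ `le_two_pow_rank_of_noAdjacentCols` — no two adjacent column positions ⟹ `n ≤ 2^{rank M_π}`.

Honest framing: bookkeeping plus the dual classes (cut words with no `CC`, or no two `C` at distance `d`);
`LiouvilleCutRank`, `DigitalBilinearLiouville`, `AlgebraicSarnak` stay OPEN; nothing bears on `VP ≠ VNP`.  No definitions.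
-/

set_option linter.dupNamespace false

noncomputable section

namespace Summit.ValiantsHypothesis.ValiantsHypothesis.Theorems.LiouvilleSarnakLiouvilleCutRank.CutTranspose

open ArithmeticFunction Finset

open Summit.ValiantsHypothesis.ValiantsHypothesis.Theorems.LiouvilleSarnakLiouvilleCutRank.ShiftCertificates
  (card_le_two_pow_rank_of_shift)
open Summit.ValiantsHypothesis.ValiantsHypothesis.Theorems.LiouvilleSarnakLiouvilleCutRank.NoAdjacentRows
  (le_two_pow_rank_of_noAdjacentRows)

/-- Swapping row and column bits transposes the cut matrix. [folklore] -/
theorem cutMatrix_swap_eq_transpose (n : ℕ) (π : Fin n ⊕ Fin n ≃ Fin (2 * n)) :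
    (Matrix.of fun r c : Fin n → Bool =>
      (((liouville (Nat.ofBits (fun k : Fin (2 * n) =>
        Sum.elim r c (((Equiv.sumComm (Fin n) (Fin n)).trans π).symm k)) + 1) : ℤ) : ℂ))) =
    (Matrix.of fun r c : Fin n → Bool =>
      (((liouville (Nat.ofBits (fun k : Fin (2 * n) => Sum.elim r c (π.symm k)) + 1) : ℤ) : ℂ))).transpose := by
  ext r c
  simp only [Matrix.of_apply, Matrix.transpose_apply]
  congr 3
  refine congrArg Nat.ofBits (funext fun k => ?_)
  simp only [Equiv.symm_trans_apply, Equiv.sumComm_symm, Equiv.sumComm_apply]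
  cases π.symm k <;> rfl

/-- Hence the rank is unchanged under swapping rows and columns. [folklore] -/
theorem rank_cutMatrix_swap (n : ℕ) (π : Fin n ⊕ Fin n ≃ Fin (2 * n)) :
    (Matrix.of fun r c : Fin n → Bool =>
      (((liouville (Nat.ofBits (fun k : Fin (2 * n) =>
        Sum.elim r c (((Equiv.sumComm (Fin n) (Fin n)).trans π).symm k)) + 1) : ℤ) : ℂ))).rank =
    (Matrix.of fun r c : Fin n → Bool =>
      (((liouville (Nat.ofBits (fun k : Fin (2 * n) => Sum.elim r c (π.symm k)) + 1) : ℤ) : ℂ))).rank := by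
  rw [cutMatrix_swap_eq_transpose, Matrix.rank_transpose]

/-- ★ **Column dual of the shift certificates.**  `d ≥ 1`, `λ(2^d + 1) = -1`, no two COLUMN positions at distance
exactly `d` ⟹ the number of column positions `j` with `j + d < 2n` and no column position in `(j, j+d]` is at most
`2^{rank M_π}`. [this file] -/
theorem card_le_two_pow_rank_of_shift_cols (n d : ℕ) (hd : 1 ≤ d) (hl : liouville (2 ^ d + 1) = -1)
    (π : Fin n ⊕ Fin n ≃ Fin (2 * n))
    (hCC : ∀ i i' : Fin n, (π (Sum.inr i') : ℕ) ≠ (π (Sum.inr i) : ℕ) + d) :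
    ((Finset.univ : Finset (Fin n)).filter (fun i => (π (Sum.inr i) : ℕ) + d < 2 * n ∧
        ∀ i' : Fin n, ¬ ((π (Sum.inr i) : ℕ) < (π (Sum.inr i') : ℕ) ∧
          (π (Sum.inr i') : ℕ) ≤ (π (Sum.inr i) : ℕ) + d))).card ≤
      2 ^ (Matrix.of fun r c : Fin n → Bool =>
        (((liouville (Nat.ofBits (fun k : Fin (2 * n) => Sum.elim r c (π.symm k)) + 1) : ℤ) : ℂ))).rank := by
  have h := card_le_two_pow_rank_of_shift n d hd hl ((Equiv.sumComm (Fin n) (Fin n)).trans π)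
    (by simpa using hCC)
  rw [rank_cutMatrix_swap] at h
  simpa using h

/-- ★ **No two adjacent column positions ⟹ `n ≤ 2^{rank}`** (dual of `…NoAdjacentRows`). [this file] -/
theorem le_two_pow_rank_of_noAdjacentCols (n : ℕ) (π : Fin n ⊕ Fin n ≃ Fin (2 * n))
    (hCC : ∀ i i' : Fin n, (π (Sum.inr i') : ℕ) ≠ (π (Sum.inr i) : ℕ) + 1) :
    n ≤ 2 ^ (Matrix.of fun r c : Fin n → Bool =>
      (((liouville (Nat.ofBits (fun k : Fin (2 * n) => Sum.elim r c (π.symm k)) + 1) : ℤ) : ℂ))).rank := by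
  have h := le_two_pow_rank_of_noAdjacentRows n ((Equiv.sumComm (Fin n) (Fin n)).trans π) (by simpa using hCC)
  rwa [rank_cutMatrix_swap] at h

end Summit.ValiantsHypothesis.ValiantsHypothesis.Theorems.LiouvilleSarnakLiouvilleCutRank.CutTranspose

end
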